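import Mathlib
import Summits.Ventures.HodgeRepro.Tier4.Common.HaarProductSetIntegral
import Summits.Ventures.HodgeRepro.Tier4.Common.HaarProductIntegralMul

/-!
# Tier4/Common/HaarProductSetIntegralMul — the SET integral of a PRODUCT function over the product domain
`e.symm '' (univ ×ˢ S)` against `μ = c • (e.symm)_*(ν₁ ⊗ ν₂)` is `c` times (the integral over `H₁`) × (the integral over `S`)

Blind re-derivation cell `pub-hodge-repro`, Tier 4 (README §9–§10), seat t4-typer-1 (gen 2).  Target tree path
`lean/Summits/Ventures/HodgeRepro/Tier4/Common/HaarProductSetIntegralMul.lean`.  Imports `HaarProductSetIntegral`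
(p695789: the restriction identity `restrict_smul_map_symm_univ_prod`) and `HaarProductIntegralMul` (p694998: the product
integral `integral_map_symm_prod_mul`, no integrability).

WHAT IS TYPED — the GENERIC shape of plan-4's C-L4-PRODINT second statement (Factorisation-STATEMENTS-v2 Part 4,
`setIntegral_chi_innerFull_prodDomain_eq`: «on the product domain, for a product integrand, the set integral is
`c · (∫_{T_∞} …) · (∫_{DZ_f} …)`»): **`setIntegral_image_symm_univ_prod_mul`** — for `μ = c • Measure.map e.symm (ν₁.prod ν₂)`
and `F x = F₁ (e x).1 * F₂ (e x).2` pointwise, `∫ x in e.symm '' (univ ×ˢ S), F x ∂μ = (c : ℝ) • ((∫ a, F₁ a ∂ν₁) * ∫ b in S, F₂ b ∂ν₂)`,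
with NO integrability hypothesis (a non-integrable factor makes both sides `0`) and `S` any subset of `H₂`.
At `e := torusSplit W`, `S := DZ_f`, `F t := χ(t) · innerFull F γ₀ t` with INNERSPLIT's factorisation of `innerFull` and
`chi_mul`, this is PRODINT's display up to the bookkeeping of the factors.

Nothing here says anything about the status of the Hodge conjecture for CM abelian varieties, which is NOT proved
(HC_CM is NOT proved by anyone in this repository).
-/

set_option autoImplicit false

noncomputable section

open MeasureTheory Measure Set Function
open scoped NNReal ENNReal

namespace Summit.Ventures.HodgeRepro.Tier4.Common

section HaarProductSetIntegralMul

variable {G H₁ H₂ : Type*}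
  [Group G] [TopologicalSpace G] [MeasurableSpace G] [BorelSpace G]
  [Group H₁] [TopologicalSpace H₁] [MeasurableSpace H₁] [BorelSpace H₁]
  [Group H₂] [TopologicalSpace H₂] [MeasurableSpace H₂] [BorelSpace H₂] [SecondCountableTopology H₂]

/-- **The set integral of a pointwise product function over the product domain `e.symm '' (univ ×ˢ S)` against
`μ = c • (e.symm)_*(ν₁ ⊗ ν₂)` is `c` times the product of the integral over `H₁` and the integral over `S`** — no
integrability hypothesis, `S` any subset of `H₂`. -/
theorem setIntegral_image_symm_univ_prod_mul (e : G ≃ₜ* H₁ × H₂) (μ : Measure G)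
    (ν₁ : Measure H₁) [SFinite ν₁] (ν₂ : Measure H₂) [SFinite ν₂]
    (c : ℝ≥0) (hc : μ = c • Measure.map e.symm (ν₁.prod ν₂)) (S : Set H₂)
    (F : G → ℂ) (F₁ : H₁ → ℂ) (F₂ : H₂ → ℂ) (hF : ∀ x, F x = F₁ (e x).1 * F₂ (e x).2) :
    ∫ x in e.symm '' ((univ : Set H₁) ×ˢ S), F x ∂μ =
      (c : ℝ) • ((∫ a, F₁ a ∂ν₁) * ∫ b in S, F₂ b ∂ν₂) := by
  subst hc
  rw [restrict_smul_map_symm_univ_prod e ν₁ ν₂ c S, integral_smul_nnreal_measure, NNReal.smul_def]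
  congr 1
  simp_rw [hF]
  exact integral_map_symm_prod_mul e ν₁ (ν₂.restrict S) F₁ F₂

end HaarProductSetIntegralMul

end Summit.Ventures.HodgeRepro.Tier4.Common
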